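import Summits.QuantumFields.YangMills.Theorems.TwistedTraceScaling.Negative.ClockRigidity
import HarnessLib

/-!
# `TwistedTraceScaling` (crux stmt-QuantumFields-20203, route `LuscherReduction`, skeleton «twolattice» rev 2):
# negative-side support VII-c — CLOCK ROBUSTNESS: asymptotically correct clocks DO carry the femto trace law (mod FTL); with VII-b this
# pins the precision of the matched number `1/ḡ²` EXACTLY (refuter crux-disprover seat; this file does NOT refute the crux)

HONEST FRAMING: `TwistedTraceScaling` is a femto-rung (R2b1) crux of a CONDITIONAL reduction route; nothing here is a mass-gap or
Clay statement.  All objects are the tree's; every law is SPELLED OUT (no proposition under `Summits/`, no `Theses` import); `FTL` = the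
right-hand side of `Tower.twistedTraceScaling_iff_femtoTraceLaw` (so `FTL ↔ TwistedTraceScaling`).

CONTENT (sorry-free, standard axioms):
* `continuousAt_hTraceRatio`: `r_𝔥` is continuous at every `s > 0` (the tree's sequential continuity `TraceDoor.tendsto_hTraceRatio`).
* ★ `traceLaw_of_asymptoticClock` (POSITIVE, mod FTL): a competitor step clock `T'(s, β, L)` that is SANDWICHED by the crux's clock at
  neighbouring femto-times — for every `η ∈ (0,1)` and `s > 0`, at all small depths, eventually in `L`, throughout the window,
  `⌈(1−η)sL/Λ⌉ ≤ T'(s, β, L) ≤ ⌈(1+η)sL/Λ⌉` — carries the femto trace law: `r(L, β, T'(s,β,L)) → r_𝔥(s)` in the crux's sense.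
  Mechanism: monotonicity in `T` (`traceRatio_mono`, VII-a) squeezes `r(T')` between `r` at the two neighbouring crux clocks, FTL evaluates
  those, continuity of `r_𝔥` closes the gap.  (FTL has no uniformity in `s`; monotonicity is what makes two FIXED neighbouring times suffice.)
* ★★ INSTANCE `traceLaw_of_boundedLabelError`: every running label `1/ḡ²(β, L) + R(β, L)` with an ABSOLUTELY BOUNDED error `|R| ≤ D`
  (clock `(max (1/ḡ² + R) 0)^{−1/3}`) carries the law, given FTL — because in the window `1/ḡ² ≥ 1/(8lam³)`
  (`invRunningCoupling_ge_of_window`), so the RELATIVE error is `≤ 8D·lam³ → 0`.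

THE EXACT PRECISION OF THE MATCHED NUMBER (VII-b + VII-c, all mod FTL = the crux; design fact for TOWER-E1 / RG lines, cf. the owner's
RG-KIT (c2) «`1/g²_{K'}` vs `β₁/2` to RELATIVE o(1)» and card clock-calibration-split's «two-loop + O(1) bounded remainder suffices,
nothing less»): writing the competitor clock as `Λ'` with label `A' = Λ'⁻³`,
  — `Λ'/Λ → 1` uniformly as `lam → 0` (e.g. `|A' − 1/ḡ²| = O(1)`, relative `O(lam³)`): the law HOLDS at `Λ'` (this file);
  — `Λ'/Λ ≡ θ ≠ 1` (relative label error `θ⁻³ − 1 ≠ 0`): the law FAILS at `Λ'` (`misclockSteps_eq_one`, VII-b);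
  — `Λ'/Λ → 0` along the window (e.g. `A' − 1/ḡ² → +∞`: one-loop running, any `log β` coefficient below `b₁/b₀`): the law FAILS at `Λ'`
    (`not_traceLaw_of_slowClock`, `not_clockTraceLaw_of_femtoTraceLaw`, VII-b).
So "relative `o(1)` on `1/ḡ²`" is both sufficient and (along constant or divergent relative errors) necessary — kernel-checked.
-/

set_option autoImplicit false

noncomputable section

open MeasureTheory Filter Topology Real
open Literature.MathematicalPhysics.QuantumFieldTheory hiding SU2
open Literature.MathematicalPhysics.QuantumLattice
open Literature.Analysis.OperatorTheory.YMMatrixModel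
open scoped BigOperators

namespace Summit.QuantumFields.YangMills.Theorems.TwistedTraceScaling.Negative

open Summit.QuantumFields.YangMills.Theorems.FemtoTransferGap
open Summit.QuantumFields.YangMills.Theorems.FemtoTransferGap.TraceDoor
open Summit.QuantumFields.YangMills.Theorems.FemtoTransferGap.TT
open Summit.QuantumFields.YangMills.Theorems.FemtoTransferGap.TwoLattice

/-! ## §5 Robustness: asymptotically correct clocks carry the law -/

/-- `r_𝔥` is continuous at every `s > 0` (from the tree's sequential continuity `tendsto_hTraceRatio`). [folklore] -/
theorem continuousAt_hTraceRatio {s : ℝ} (hs : 0 < s) : ContinuousAt hTraceRatio s :=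
  (tendsto_iff_seq_tendsto (f := hTraceRatio) (k := 𝓝 s) (l := 𝓝 (hTraceRatio s))).mpr fun _ hσ => tendsto_hTraceRatio hs hσ

/-- ★ **Asymptotically correct clocks carry the femto trace law (mod FTL).**  If a competitor step clock `T'` satisfies, for every
`η ∈ (0,1)` and `s > 0`, at all small depths, eventually in `L`, throughout the window, `⌈(1−η)sL/Λ⌉ ≤ T'(s,β,L) ≤ ⌈(1+η)sL/Λ⌉`, then FTL
implies the femto trace law clocked by `T'` (monotonicity in `T` + FTL at the two neighbouring times + continuity of `r_𝔥`). [folklore] -/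
theorem traceLaw_of_asymptoticClock
    (hFTL : ∀ s : ℝ, 0 < s → ∀ ε : ℝ, 0 < ε → ∃ lam0 : ℝ, 0 < lam0 ∧ ∀ lam : ℝ, 0 < lam → lam ≤ lam0 →
      ∃ L0 : ℕ, ∀ (L : ℕ) [NeZero L], L0 ≤ L → ∀ β : ℝ, InFemtoWindow lam β L →
        |traceRatio L β (femtoSteps s β L) - hTraceRatio s| ≤ ε)
    {T' : ℝ → ℝ → ℕ → ℕ}
    (hclose : ∀ η : ℝ, 0 < η → η < 1 → ∀ s : ℝ, 0 < s → ∃ lam1 : ℝ, 0 < lam1 ∧ ∀ lam : ℝ, 0 < lam → lam ≤ lam1 →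
      ∃ L1 : ℕ, ∀ (L : ℕ) [NeZero L], L1 ≤ L → ∀ β : ℝ, InFemtoWindow lam β L →
        femtoSteps ((1 - η) * s) β L ≤ T' s β L ∧ T' s β L ≤ femtoSteps ((1 + η) * s) β L) :
    ∀ s : ℝ, 0 < s → ∀ ε : ℝ, 0 < ε → ∃ lam0 : ℝ, 0 < lam0 ∧ ∀ lam : ℝ, 0 < lam → lam ≤ lam0 →
      ∃ L0 : ℕ, ∀ (L : ℕ) [NeZero L], L0 ≤ L → ∀ β : ℝ, InFemtoWindow lam β L →
        |traceRatio L β (T' s β L) - hTraceRatio s| ≤ ε := by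
  intro s hs ε hε
  obtain ⟨δ, hδ, hcont⟩ := Metric.continuousAt_iff.mp (continuousAt_hTraceRatio hs) (ε / 2) (by positivity)
  -- a relative time shift `η ≤ 1/2` with `η s < δ`
  obtain ⟨η, hη0, hη1, hηs⟩ : ∃ η : ℝ, 0 < η ∧ η ≤ 1 / 2 ∧ η * s < δ := by
    refine ⟨min (δ / (2 * s)) (1 / 2), by positivity, min_le_right _ _, ?_⟩
    calc min (δ / (2 * s)) (1 / 2) * s ≤ δ / (2 * s) * s := mul_le_mul_of_nonneg_right (min_le_left _ _) hs.le
      _ = δ / 2 := by field_simp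
      _ < δ := by linarith
  have hs1 : 0 < (1 - η) * s := by nlinarith
  have hs2 : 0 < (1 + η) * s := by positivity
  have hr1 : |hTraceRatio ((1 - η) * s) - hTraceRatio s| < ε / 2 := by
    have h := hcont (x := (1 - η) * s)
      (by rw [Real.dist_eq, show (1 - η) * s - s = -(η * s) by ring, abs_neg, abs_of_pos (by positivity)]; exact hηs)
    rwa [Real.dist_eq] at h
  have hr2 : |hTraceRatio ((1 + η) * s) - hTraceRatio s| < ε / 2 := by
    have h := hcont (x := (1 + η) * s)
      (by rw [Real.dist_eq, show (1 + η) * s - s = η * s by ring, abs_of_pos (by positivity)]; exact hηs)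
    rwa [Real.dist_eq] at h
  obtain ⟨lamA, hlamA, HA⟩ := hFTL ((1 - η) * s) hs1 (ε / 2) (by positivity)
  obtain ⟨lamB, hlamB, HB⟩ := hFTL ((1 + η) * s) hs2 (ε / 2) (by positivity)
  obtain ⟨lam1, hlam1, H1⟩ := hclose η hη0 (by linarith) s hs
  refine ⟨min (min lamA lamB) (min lam1 1), lt_min (lt_min hlamA hlamB) (lt_min hlam1 one_pos), fun lam hl0 hle => ?_⟩
  have hlA : lam ≤ lamA := hle.trans ((min_le_left _ _).trans (min_le_left _ _))
  have hlB : lam ≤ lamB := hle.trans ((min_le_left _ _).trans (min_le_right _ _))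
  have hl1 : lam ≤ lam1 := hle.trans ((min_le_right _ _).trans (min_le_left _ _))
  have hl_one : lam ≤ 1 := hle.trans ((min_le_right _ _).trans (min_le_right _ _))
  obtain ⟨LA, HLA⟩ := HA lam hl0 hlA
  obtain ⟨LB, HLB⟩ := HB lam hl0 hlB
  obtain ⟨L1, HL1⟩ := H1 lam hl0 hl1
  refine ⟨max (max LA LB) (max L1 (⌈4 / s⌉₊ + 1)), fun L _ hL β hW => ?_⟩
  have hLA : LA ≤ L := ((le_max_left _ _).trans (le_max_left _ _)).trans hL
  have hLB : LB ≤ L := ((le_max_right _ _).trans (le_max_left _ _)).trans hL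
  have hL1 : L1 ≤ L := ((le_max_left _ _).trans (le_max_right _ _)).trans hL
  have hL4 : ⌈4 / s⌉₊ + 1 ≤ L := ((le_max_right _ _).trans (le_max_right _ _)).trans hL
  have hl : 0 < luscherLambda β L := luscherLambda_pos_of_window hl0 hW
  -- the lower neighbouring clock has at least two steps
  have hsL : 4 < s * L := by
    have h1 : (4 / s : ℝ) < L := (Nat.le_ceil _).trans_lt (by exact_mod_cast hL4)
    rw [div_lt_iff₀ hs] at h1
    linarith
  have hT1 : 2 ≤ femtoSteps ((1 - η) * s) β L := by
    have h1 : 1 < femtoSteps ((1 - η) * s) β L := by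
      unfold femtoSteps
      refine Nat.lt_ceil.mpr ?_
      rw [Nat.cast_one, lt_div_iff₀ hl]
      have h2 : 1 / 2 * (s * L) ≤ (1 - η) * (s * L) := mul_le_mul_of_nonneg_right (by linarith) (by positivity)
      have h3 : (1 - η) * s * L = (1 - η) * (s * L) := by ring
      linarith [hW.2.2]
    omega
  obtain ⟨hlo, hhi⟩ := HL1 L hL1 β hW
  have m1 := traceRatio_mono L hW.1 hT1 hlo
  have m2 := traceRatio_mono L hW.1 (hT1.trans hlo) hhi
  have eA := abs_le.mp (HLA L hLA β hW)
  have eB := abs_le.mp (HLB L hLB β hW)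
  have f1 := abs_lt.mp hr1
  have f2 := abs_lt.mp hr2
  rw [abs_le]
  constructor <;> linarith

/-- In the window the label is bounded BELOW by the depth: `1/(8lam³) ≤ 1/ḡ²(β, L)` (`Λ ≤ 2lam`, `Λ³ = ḡ²`). [folklore] -/
theorem invRunningCoupling_ge_of_window {lam β : ℝ} {L : ℕ} (hlam : 0 < lam) (hW : InFemtoWindow lam β L) :
    1 / (8 * lam ^ 3) ≤ invRunningCoupling β L := by
  have hl : 0 < luscherLambda β L := luscherLambda_pos_of_window hlam hW
  have hv : 0 < invRunningCoupling β L := BOHandover.invRunningCoupling_pos_of_luscherLambda_pos hl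
  have h3 : luscherLambda β L ^ 3 ≤ (2 * lam) ^ 3 := pow_le_pow_left₀ hl.le hW.2.2 3
  rw [BOHandover.luscherLambda_pow_three hv] at h3
  rw [div_le_iff₀ (by positivity), ← div_le_iff₀' hv, div_eq_inv_mul, mul_one]
  nlinarith

/-- ★★ **An absolutely bounded error in the matched number is invisible (mod FTL).**  For every error term `R(β, L)` with `|R| ≤ D`,
the femto trace law clocked by the perturbed label `1/ḡ²(β, L) + R(β, L)` — clock `Λ_R = (max (1/ḡ² + R) 0)^{−1/3}`, steps `⌈sL/Λ_R⌉`,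
window unchanged — follows from FTL: in the window `1/ḡ² ≥ 1/(8lam³)`, so the relative error is `≤ 8D·lam³` and the perturbed clock is
sandwiched by the crux's clock at times `(1∓η)s` once `lam ≤ η/(8(D+1))`. [folklore] -/
theorem traceLaw_of_boundedLabelError
    (hFTL : ∀ s : ℝ, 0 < s → ∀ ε : ℝ, 0 < ε → ∃ lam0 : ℝ, 0 < lam0 ∧ ∀ lam : ℝ, 0 < lam → lam ≤ lam0 →
      ∃ L0 : ℕ, ∀ (L : ℕ) [NeZero L], L0 ≤ L → ∀ β : ℝ, InFemtoWindow lam β L →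
        |traceRatio L β (femtoSteps s β L) - hTraceRatio s| ≤ ε)
    {R : ℝ → ℕ → ℝ} {D : ℝ} (hR : ∀ (β : ℝ) (L : ℕ), |R β L| ≤ D) :
    ∀ s : ℝ, 0 < s → ∀ ε : ℝ, 0 < ε → ∃ lam0 : ℝ, 0 < lam0 ∧ ∀ lam : ℝ, 0 < lam → lam ≤ lam0 →
      ∃ L0 : ℕ, ∀ (L : ℕ) [NeZero L], L0 ≤ L → ∀ β : ℝ, InFemtoWindow lam β L →
        |traceRatio L β ⌈s * L / (max (invRunningCoupling β L + R β L) 0) ^ (-(1 : ℝ) / 3)⌉₊ - hTraceRatio s| ≤ ε := by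
  have hD : 0 ≤ D := (abs_nonneg _).trans (hR 0 0)
  refine traceLaw_of_asymptoticClock hFTL
    (T' := fun s β L => ⌈s * L / (max (invRunningCoupling β L + R β L) 0) ^ (-(1 : ℝ) / 3)⌉₊) ?_
  intro η hη0 hη1 s hs
  refine ⟨min 1 (η / (8 * (D + 1))), by positivity, fun lam hl0 hle => ⟨0, fun L _ _ β hW => ?_⟩⟩
  have hl_one : lam ≤ 1 := hle.trans (min_le_left _ _)
  have hlη : lam ≤ η / (8 * (D + 1)) := hle.trans (min_le_right _ _)
  have hl : 0 < luscherLambda β L := luscherLambda_pos_of_window hl0 hW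
  obtain ⟨hv, -⟩ := invRunningCoupling_le_of_window hl0 hW
  have hvge := invRunningCoupling_ge_of_window hl0 hW
  set v := invRunningCoupling β L with hvdef
  -- `D < η v`: `D + 1 ≤ η/(8 lam) ≤ η/(8 lam³) ≤ η v`
  have hlam3 : lam ^ 3 ≤ lam := by
    have : lam ^ 3 = lam * (lam * lam) := by ring
    nlinarith [mul_le_one₀ hl_one hl0.le hl_one]
  have hDv : D < η * v := by
    have h1 : D + 1 ≤ η / (8 * lam) := by
      rw [le_div_iff₀ (by positivity)]
      rw [le_div_iff₀ (by positivity)] at hlη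
      nlinarith
    have h2 : η / (8 * lam) ≤ η / (8 * lam ^ 3) :=
      div_le_div_of_nonneg_left hη0.le (by positivity) (by nlinarith)
    have h3 : η / (8 * lam ^ 3) ≤ η * v := by
      rw [show η / (8 * lam ^ 3) = η * (1 / (8 * lam ^ 3)) by ring]
      exact mul_le_mul_of_nonneg_left hvge hη0.le
    linarith
  have hRb := abs_le.mp (hR β L)
  set A := v + R β L with hAdef
  have hAlo : (1 - η) ^ 3 * v ≤ A := by
    have h1 : (1 - η) ^ 3 ≤ 1 - η := by nlinarith [pow_le_one₀ (by linarith : 0 ≤ 1 - η) (by linarith : 1 - η ≤ 1) (n := 2)]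
    nlinarith
  have hAhi : A ≤ (1 + η) ^ 3 * v := by
    have h1 : 1 + η ≤ (1 + η) ^ 3 := by
      have h2 : (1 : ℝ) ≤ (1 + η) ^ 2 := by nlinarith
      nlinarith [mul_le_mul_of_nonneg_left h2 (by linarith : (0 : ℝ) ≤ 1 + η)]
    nlinarith
  have hA0 : 0 < A := lt_of_lt_of_le (by positivity) hAlo
  have hc0 : 0 < (max A 0) ^ (-(1 : ℝ) / 3) := max_rpow_neg_third_pos hA0
  have hc3 : ((max A 0) ^ (-(1 : ℝ) / 3)) ^ 3 = A⁻¹ := max_rpow_neg_third_pow_three hA0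
  have hΛ3 : luscherLambda β L ^ 3 = v⁻¹ := BOHandover.luscherLambda_pow_three hv
  -- the two clock comparisons, through cubes
  have hlow : (1 - η) * (max A 0) ^ (-(1 : ℝ) / 3) ≤ luscherLambda β L := by
    refine le_of_pow_le_pow_left₀ (by norm_num : (3 : ℕ) ≠ 0) hl.le ?_
    rw [mul_pow, hc3, hΛ3, ← div_eq_mul_inv, div_le_iff₀ hA0, ← div_eq_inv_mul, le_div_iff₀ hv]
    exact hAlo
  have hhigh : luscherLambda β L ≤ (1 + η) * (max A 0) ^ (-(1 : ℝ) / 3) := by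
    refine le_of_pow_le_pow_left₀ (by norm_num : (3 : ℕ) ≠ 0) (by positivity) ?_
    rw [mul_pow, hc3, hΛ3, ← div_eq_mul_inv, le_div_iff₀ hA0, ← div_eq_inv_mul, div_le_iff₀ hv]
    exact hAhi
  have hsL : 0 ≤ s * (L : ℝ) := by positivity
  constructor
  · unfold femtoSteps
    apply Nat.ceil_mono
    rw [div_le_div_iff₀ hl hc0]
    calc (1 - η) * s * L * (max A 0) ^ (-(1 : ℝ) / 3) = s * L * ((1 - η) * (max A 0) ^ (-(1 : ℝ) / 3)) := by ring
      _ ≤ s * L * luscherLambda β L := mul_le_mul_of_nonneg_left hlow hsL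
  · show ⌈s * L / (max A 0) ^ (-(1 : ℝ) / 3)⌉₊ ≤ femtoSteps ((1 + η) * s) β L
    unfold femtoSteps
    apply Nat.ceil_mono
    rw [div_le_div_iff₀ hc0 hl]
    calc s * L * luscherLambda β L ≤ s * L * ((1 + η) * (max A 0) ^ (-(1 : ℝ) / 3)) := mul_le_mul_of_nonneg_left hhigh hsL
      _ = (1 + η) * s * L * (max A 0) ^ (-(1 : ℝ) / 3) := by ring

end Summit.QuantumFields.YangMills.Theorems.TwistedTraceScaling.Negative

end
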